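import Mathlib.Probability.Moments.Variance
import Literature.MathematicalPhysics.KineticTheory.HardSphereCanonicalClusterBound
import Literature.Probability.Moments.DecorrelationExtensionCovariance
import HarnessLib

/-!
# Variance of a decorated near-contact pair sum under the canonical hard-sphere measure

Topic `Literature/MathematicalPhysics/KineticTheory` (kind proof; rung-0 statics of the TUBE side of the
Enskog closure, crux line `even-rung-mean-variance` of `JParityClosure.EvenStressEnskog`,
stmt-AtomisticToContinuum-13079).  For `N + 1` hard spheres of diameter `ε_N = hsDiameter σ N` on `𝕋³`
under the configurational canonical measure `P_N = posGibbsMeasure 1 ε_N (N+1)` at small reduced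
density, consider the DECORATED PAIR SUM

  `S(x) = Σ_{i ≠ j} h(xᵢ) φ(xⱼ − xᵢ)`,  `|h| ≤ 1`, `|φ| ≤ B`, `φ` supported in a symmetric set `D`

(in the application `φ` is the velocity average of a collision-tube mark, supported in the
near-contact shell `D` of Haar volume `v = O(ε_N³)`, and `h = χ(t, ·)` is the macroscopic test
function).  Its variance is the sum over pairs of ordered pairs of `Cov(X_{ij}, X_{kl})`:

* both labels shared: `|Cov| ≤ 8 B² v` (Ruelle pair bound `posGibbs_pairEvent_le`), `2(N+1)²` terms;
* one label shared: `|Cov| ≤ 24 B² v²` (`posGibbs_tripleEvent_le` and the pair bound), `≤ 4(N+1)³` terms;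
* disjoint pairs: `|Cov| ≤ 4 ζ B² v²` GIVEN the decorated pair-pair decorrelation bound at level `ζ`
  for indicators (hypothesis `hdec`; extended to `φ` by
  `Literature.Probability.Moments.abs_covariance_le_of_indicator_of_abs_le`), `≤ (N+1)⁴` terms;

whence (`variance_decoratedPairSum_le`)
`Var_{P_N}(S) ≤ (N+1)² (16 B² v + 96 (N+1) B² v² + 4 ζ (N+1)² B² v²)`.
With `v ∝ σ³/(N+1)` and the normalisation `((N+1)κ)⁻²` of the collision-tube functional the three
terms are `O(1/N)`, `O(1/N)` and `O(ζ)`.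

## References

* D. Ruelle, *Statistical Mechanics: Rigorous Results* (1969), §4.2.  [Ruelle1969]
* E. Pulvirenti, D. Tsagkarogiannis, Comm. Math. Phys. 316 (2012) 289–306, §3.  [PulvirentiTsagkarogiannis2012]
-/

noncomputable section

namespace Literature.MathematicalPhysics.KineticTheory

open MeasureTheory ProbabilityTheory Set
open scoped ENNReal
open Literature.Probability.Moments

variable {σ : ℝ} {N : ℕ}

/-! ## Real-valued forms of the Ruelle bounds -/

/-- The canonical pair bound in real form: `P_N{x_i − x_j ∈ T} ≤ 4 vol(T)`. [folklore] -/
theorem posGibbs_real_pairEvent_le (hsd : SmallDensity uniformProfile σ) (hN : 1 ≤ N) {i j : Fin (N + 1)}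
    (hij : i ≠ j) {T : Set T3} (hT : MeasurableSet T) :
    (posGibbsMeasure (fun _ : T3 => (1 : ℝ)) (hsDiameter σ N) (N + 1)).real {x | x i - x j ∈ T} ≤
      4 * (volume T).toReal := by
  rw [measureReal_def]
  have hfin : (4 : ℝ≥0∞) * volume T ≠ ∞ := ENNReal.mul_ne_top (by norm_num) (measure_ne_top _ _)
  calc (posGibbsMeasure (fun _ : T3 => (1 : ℝ)) (hsDiameter σ N) (N + 1) {x | x i - x j ∈ T}).toReal
      ≤ ((4 : ℝ≥0∞) * volume T).toReal := ENNReal.toReal_mono hfin (posGibbs_pairEvent_le hsd hN hij hT)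
    _ = 4 * (volume T).toReal := by rw [ENNReal.toReal_mul]; norm_num

/-- The canonical three-label bound in real form:
`P_N{x_j − x_i ∈ T, x_k − x_i ∈ T'} ≤ 8 vol(T) vol(T')`. [folklore] -/
theorem posGibbs_real_tripleEvent_le (hsd : SmallDensity uniformProfile σ) {i j k : Fin (N + 1)}
    (hij : i ≠ j) (hik : i ≠ k) (hjk : j ≠ k) {T T' : Set T3} (hT : MeasurableSet T) (hT' : MeasurableSet T') :
    (posGibbsMeasure (fun _ : T3 => (1 : ℝ)) (hsDiameter σ N) (N + 1)).real
        {x | x j - x i ∈ T ∧ x k - x i ∈ T'} ≤ 8 * (volume T).toReal * (volume T').toReal := by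
  rw [measureReal_def]
  have hfin := ENNReal.mul_ne_top (by norm_num : (8 : ℝ≥0∞) ≠ ∞) (ENNReal.mul_ne_top (measure_ne_top volume T) (measure_ne_top volume T'))
  calc (posGibbsMeasure (fun _ : T3 => (1 : ℝ)) (hsDiameter σ N) (N + 1) {x | x j - x i ∈ T ∧ x k - x i ∈ T'}).toReal
      ≤ ((8 : ℝ≥0∞) * (volume T * volume T')).toReal := ENNReal.toReal_mono hfin (posGibbs_tripleEvent_le hsd hij hik hjk hT hT')
    _ = 8 * (volume T).toReal * (volume T').toReal := by rw [ENNReal.toReal_mul, ENNReal.toReal_mul]; norm_num; ring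

/-! ## The decorated pair variable and its support -/

/-- `|h(xᵢ) φ(xⱼ − xᵢ)| ≤ B · 𝟙{xⱼ − xᵢ ∈ D}` for `|h| ≤ 1`, `|φ| ≤ B`, `φ` supported in `D`. [folklore] -/
theorem abs_decorated_le_indicator {h φ : T3 → ℝ} (hh1 : ∀ y, |h y| ≤ 1) {B : ℝ} (hφB : ∀ d, |φ d| ≤ B)
    {D : Set T3} (hφD : ∀ d, φ d ≠ 0 → d ∈ D) (i j : Fin (N + 1)) (x : Fin (N + 1) → T3) :
    |h (x i) * φ (x j - x i)| ≤ B * {x : Fin (N + 1) → T3 | x j - x i ∈ D}.indicator (fun _ => (1 : ℝ)) x := by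
  by_cases hx : x j - x i ∈ D
  · rw [indicator_of_mem (show x ∈ {x : Fin (N + 1) → T3 | x j - x i ∈ D} from hx), mul_one, abs_mul]
    exact (mul_le_mul (hh1 _) (hφB _) (abs_nonneg _) zero_le_one).trans_eq (one_mul B)
  · have h0 : φ (x j - x i) = 0 := by by_contra hne; exact hx (hφD _ hne)
    rw [h0, mul_zero, abs_zero, indicator_of_notMem (show x ∉ {x : Fin (N + 1) → T3 | x j - x i ∈ D} from hx), mul_zero]

/-- The same with the pair event read from the other label, for a SYMMETRIC support `D = −D`:
`|h(xᵢ) φ(xⱼ − xᵢ)| ≤ B · 𝟙{xᵢ − xⱼ ∈ D}`. [folklore] -/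
theorem abs_decorated_le_indicator' {h φ : T3 → ℝ} (hh1 : ∀ y, |h y| ≤ 1) {B : ℝ} (hφB : ∀ d, |φ d| ≤ B)
    {D : Set T3} (hDs : ∀ d, d ∈ D ↔ -d ∈ D) (hφD : ∀ d, φ d ≠ 0 → d ∈ D) (i j : Fin (N + 1)) (x : Fin (N + 1) → T3) :
    |h (x i) * φ (x j - x i)| ≤ B * {x : Fin (N + 1) → T3 | x i - x j ∈ D}.indicator (fun _ => (1 : ℝ)) x := by
  have h := abs_decorated_le_indicator hh1 hφB hφD i j x
  have hset : {x : Fin (N + 1) → T3 | x j - x i ∈ D} = {x : Fin (N + 1) → T3 | x i - x j ∈ D} := by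
    ext y; simp only [mem_setOf_eq]; rw [hDs, neg_sub]
  rwa [hset] at h

/-- `|h(xᵢ) φ(xⱼ − xᵢ)| ≤ B`. [folklore] -/
theorem abs_decorated_le {h φ : T3 → ℝ} (hh1 : ∀ y, |h y| ≤ 1) {B : ℝ} (hφB : ∀ d, |φ d| ≤ B)
    (i j : Fin (N + 1)) (x : Fin (N + 1) → T3) : |h (x i) * φ (x j - x i)| ≤ B := by
  rw [abs_mul]; exact (mul_le_mul (hh1 _) (hφB _) (abs_nonneg _) zero_le_one).trans_eq (one_mul B)

/-- The decorated pair variable is measurable. [folklore] -/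
theorem measurable_decorated {h φ : T3 → ℝ} (hh : Measurable h) (hφ : Measurable φ) (i j : Fin (N + 1)) :
    Measurable fun x : Fin (N + 1) → T3 => h (x i) * φ (x j - x i) :=
  (hh.comp (measurable_pi_apply i)).mul (hφ.comp ((measurable_pi_apply j).sub (measurable_pi_apply i)))

/-! ## The three covariance bounds -/

/-- **Case A (both labels shared, or any pair against a bounded variable).**  If `|X| ≤ B 𝟙{x_a − x_s ∈ D}`
(`s ≠ a`) and `|Y| ≤ B`, then `|Cov_{P_N}(X, Y)| ≤ 8 B² vol(D)` (`N ≥ 1`, small density). [folklore] -/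
theorem abs_covariance_le_of_pairEvent (hsd : SmallDensity uniformProfile σ) (hN : 1 ≤ N)
    {X Y : (Fin (N + 1) → T3) → ℝ} (hX : Measurable X) (hY : Measurable Y) {B : ℝ} (hB : 0 ≤ B)
    {D : Set T3} (hD : MeasurableSet D) {s a : Fin (N + 1)} (hsa : s ≠ a)
    (hXE : ∀ x, |X x| ≤ B * {x : Fin (N + 1) → T3 | x a - x s ∈ D}.indicator (fun _ => (1 : ℝ)) x)
    (hYB : ∀ x, |Y x| ≤ B) :
    |cov[X, Y; posGibbsMeasure (fun _ : T3 => (1 : ℝ)) (hsDiameter σ N) (N + 1)]| ≤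
      8 * B ^ 2 * (volume D).toReal := by
  haveI := isProbabilityMeasure_posGibbsMeasure continuous_const (fun _ => one_pos) hsd.σ_lt_half.le N
  have hYE : ∀ x, |Y x| ≤ B * (univ : Set (Fin (N + 1) → T3)).indicator (fun _ => (1 : ℝ)) x := fun x => by
    rw [indicator_of_mem (mem_univ _), mul_one]; exact hYB x
  have h := abs_covariance_le_of_abs_le_indicator
    (P := posGibbsMeasure (fun _ : T3 => (1 : ℝ)) (hsDiameter σ N) (N + 1)) hX hY
    (measurableSet_pairEvent a s hD) MeasurableSet.univ hB hB hXE hYE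
  rw [inter_univ, probReal_univ, mul_one] at h
  have hp := posGibbs_real_pairEvent_le hsd hN hsa.symm hD
  calc _ ≤ B * B * ((posGibbsMeasure (fun _ : T3 => (1 : ℝ)) (hsDiameter σ N) (N + 1)).real
          {x | x a - x s ∈ D} + (posGibbsMeasure (fun _ : T3 => (1 : ℝ)) (hsDiameter σ N) (N + 1)).real
          {x | x a - x s ∈ D}) := h
    _ ≤ B * B * (4 * (volume D).toReal + 4 * (volume D).toReal) :=
        mul_le_mul_of_nonneg_left (add_le_add hp hp) (mul_nonneg hB hB)
    _ = 8 * B ^ 2 * (volume D).toReal := by ring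

/-- **Case B (exactly one shared label).**  If `|X| ≤ B 𝟙{x_a − x_s ∈ D}` and `|Y| ≤ B 𝟙{x_b − x_s ∈ D}` with
`s, a, b` distinct, then `|Cov_{P_N}(X, Y)| ≤ 24 B² vol(D)²` (`8` from the three-label bound, `16` from
the product of the two pair bounds). [folklore] -/
theorem abs_covariance_le_of_tripleEvent (hsd : SmallDensity uniformProfile σ) (hN : 1 ≤ N)
    {X Y : (Fin (N + 1) → T3) → ℝ} (hX : Measurable X) (hY : Measurable Y) {B : ℝ} (hB : 0 ≤ B)
    {D : Set T3} (hD : MeasurableSet D) {s a b : Fin (N + 1)} (hsa : s ≠ a) (hsb : s ≠ b) (hab : a ≠ b)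
    (hXE : ∀ x, |X x| ≤ B * {x : Fin (N + 1) → T3 | x a - x s ∈ D}.indicator (fun _ => (1 : ℝ)) x)
    (hYE : ∀ x, |Y x| ≤ B * {x : Fin (N + 1) → T3 | x b - x s ∈ D}.indicator (fun _ => (1 : ℝ)) x) :
    |cov[X, Y; posGibbsMeasure (fun _ : T3 => (1 : ℝ)) (hsDiameter σ N) (N + 1)]| ≤
      24 * B ^ 2 * (volume D).toReal ^ 2 := by
  haveI := isProbabilityMeasure_posGibbsMeasure continuous_const (fun _ => one_pos) hsd.σ_lt_half.le N
  have h := abs_covariance_le_of_abs_le_indicator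
    (P := posGibbsMeasure (fun _ : T3 => (1 : ℝ)) (hsDiameter σ N) (N + 1)) hX hY
    (measurableSet_pairEvent a s hD) (measurableSet_pairEvent b s hD) hB hB hXE hYE
  have hinter : {x : Fin (N + 1) → T3 | x a - x s ∈ D} ∩ {x : Fin (N + 1) → T3 | x b - x s ∈ D} =
      {x | x a - x s ∈ D ∧ x b - x s ∈ D} := rfl
  rw [hinter] at h
  have ht := posGibbs_real_tripleEvent_le hsd hsa hsb hab hD hD
  have hpa := posGibbs_real_pairEvent_le hsd hN hsa.symm hD
  have hpb := posGibbs_real_pairEvent_le hsd hN hsb.symm hD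
  have hv : 0 ≤ (volume D).toReal := ENNReal.toReal_nonneg
  calc _ ≤ B * B * ((posGibbsMeasure (fun _ : T3 => (1 : ℝ)) (hsDiameter σ N) (N + 1)).real
          {x | x a - x s ∈ D ∧ x b - x s ∈ D} +
          (posGibbsMeasure (fun _ : T3 => (1 : ℝ)) (hsDiameter σ N) (N + 1)).real {x | x a - x s ∈ D} *
          (posGibbsMeasure (fun _ : T3 => (1 : ℝ)) (hsDiameter σ N) (N + 1)).real {x | x b - x s ∈ D}) := h
    _ ≤ B * B * (8 * (volume D).toReal * (volume D).toReal + 4 * (volume D).toReal * (4 * (volume D).toReal)) :=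
        mul_le_mul_of_nonneg_left (add_le_add ht (mul_le_mul hpa hpb measureReal_nonneg (by positivity)))
          (mul_nonneg hB hB)
    _ = 24 * B ^ 2 * (volume D).toReal ^ 2 := by ring

/-- **Case C (disjoint pairs)**, conditional on the decorated pair-pair decorrelation bound `hdec` for
indicators at level `ζ` (for the labels `i, j, k, l`): `|Cov_{P_N}(h(xᵢ)φ(xⱼ − xᵢ), h(x_k)φ(x_l − x_k))| ≤ 4 ζ B² vol(D)²`
(`Literature.Probability.Moments.abs_covariance_le_of_indicator_of_abs_le`). [folklore] -/
theorem abs_covariance_decorated_le_of_dec (hsd : SmallDensity uniformProfile σ) {h φ : T3 → ℝ}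
    (hh : Measurable h) (hh1 : ∀ y, |h y| ≤ 1) (hφ : Measurable φ) {B : ℝ} (hB : 0 < B)
    (hφB : ∀ d, |φ d| ≤ B) {D : Set T3} (hφD : ∀ d, φ d ≠ 0 → d ∈ D) {ζ : ℝ} (hζ : 0 ≤ ζ)
    {i j k l : Fin (N + 1)}
    (hdec : ∀ T T' : Set T3, MeasurableSet T → MeasurableSet T' →
      |(∫ x, h (x i) * T.indicator (fun _ => (1 : ℝ)) (x j - x i) * (h (x k) * T'.indicator (fun _ => (1 : ℝ)) (x l - x k))
          ∂posGibbsMeasure (fun _ : T3 => (1 : ℝ)) (hsDiameter σ N) (N + 1)) -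
        (∫ x, h (x i) * T.indicator (fun _ => (1 : ℝ)) (x j - x i) ∂posGibbsMeasure (fun _ : T3 => (1 : ℝ)) (hsDiameter σ N) (N + 1)) *
        (∫ x, h (x k) * T'.indicator (fun _ => (1 : ℝ)) (x l - x k) ∂posGibbsMeasure (fun _ : T3 => (1 : ℝ)) (hsDiameter σ N) (N + 1))|
        ≤ ζ * (volume T).toReal * (volume T').toReal) :
    |cov[fun x => h (x i) * φ (x j - x i), fun x => h (x k) * φ (x l - x k);
        posGibbsMeasure (fun _ : T3 => (1 : ℝ)) (hsDiameter σ N) (N + 1)]| ≤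
      4 * (ζ * B * B * (volume D).toReal * (volume D).toReal) := by
  haveI := isProbabilityMeasure_posGibbsMeasure continuous_const (fun _ => one_pos) hsd.σ_lt_half.le N
  exact abs_covariance_le_of_indicator_of_abs_le (ν := (volume : Measure T3))
    (U := fun x : Fin (N + 1) → T3 => x j - x i) (U' := fun x : Fin (N + 1) → T3 => x l - x k)
    (H := fun x : Fin (N + 1) → T3 => h (x i)) (H' := fun x : Fin (N + 1) → T3 => h (x k))
    ((measurable_pi_apply j).sub (measurable_pi_apply i)) ((measurable_pi_apply l).sub (measurable_pi_apply k))
    (hh.comp (measurable_pi_apply i)) (hh.comp (measurable_pi_apply k)) (fun x => hh1 _) (fun x => hh1 _) hζ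
    (fun T T' hT hT' => by simpa only [measureReal_def] using hdec T T' hT hT') hφ hφ hB hB hφB hφB hφD hφD

/-! ## The master bound and the summation -/

/-- **Master covariance bound.**  For ordered pairs `i ≠ j`, `k ≠ l`:
`|Cov(X_{ij}, X_{kl})| ≤ 8B²v · (𝟙[k=i,l=j] + 𝟙[k=j,l=i]) + 24B²v² · (𝟙[k=i] + 𝟙[k=j] + 𝟙[l=i] + 𝟙[l=j]) + 4ζB²v²`
(cases A, B, C according to the overlap of `{i, j}` and `{k, l}`; `D` symmetric). [folklore] -/
theorem abs_covariance_decorated_le (hsd : SmallDensity uniformProfile σ) (hN : 1 ≤ N) {h φ : T3 → ℝ}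
    (hh : Measurable h) (hh1 : ∀ y, |h y| ≤ 1) (hφ : Measurable φ) {B : ℝ} (hB : 0 < B)
    (hφB : ∀ d, |φ d| ≤ B) {D : Set T3} (hD : MeasurableSet D) (hDs : ∀ d, d ∈ D ↔ -d ∈ D)
    (hφD : ∀ d, φ d ≠ 0 → d ∈ D) {ζ : ℝ} (hζ : 0 ≤ ζ)
    (hdec : ∀ i j k l : Fin (N + 1), i ≠ j → i ≠ k → i ≠ l → j ≠ k → j ≠ l → k ≠ l →
      ∀ T T' : Set T3, MeasurableSet T → MeasurableSet T' →
      |(∫ x, h (x i) * T.indicator (fun _ => (1 : ℝ)) (x j - x i) * (h (x k) * T'.indicator (fun _ => (1 : ℝ)) (x l - x k))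
          ∂posGibbsMeasure (fun _ : T3 => (1 : ℝ)) (hsDiameter σ N) (N + 1)) -
        (∫ x, h (x i) * T.indicator (fun _ => (1 : ℝ)) (x j - x i) ∂posGibbsMeasure (fun _ : T3 => (1 : ℝ)) (hsDiameter σ N) (N + 1)) *
        (∫ x, h (x k) * T'.indicator (fun _ => (1 : ℝ)) (x l - x k) ∂posGibbsMeasure (fun _ : T3 => (1 : ℝ)) (hsDiameter σ N) (N + 1))|
        ≤ ζ * (volume T).toReal * (volume T').toReal)
    (i j k l : Fin (N + 1)) (hij : i ≠ j) (hkl : k ≠ l) :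
    |cov[fun x => h (x i) * φ (x j - x i), fun x => h (x k) * φ (x l - x k);
        posGibbsMeasure (fun _ : T3 => (1 : ℝ)) (hsDiameter σ N) (N + 1)]| ≤
      8 * B ^ 2 * (volume D).toReal *
          ((if k = i ∧ l = j then (1 : ℝ) else 0) + (if k = j ∧ l = i then (1 : ℝ) else 0)) +
        24 * B ^ 2 * (volume D).toReal ^ 2 *
          ((if k = i then (1 : ℝ) else 0) + (if k = j then (1 : ℝ) else 0) +
            (if l = i then (1 : ℝ) else 0) + (if l = j then (1 : ℝ) else 0)) +
        4 * (ζ * B * B * (volume D).toReal * (volume D).toReal) := by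
  set v : ℝ := (volume D).toReal with hv
  have hv0 : 0 ≤ v := ENNReal.toReal_nonneg
  have hbA : 0 ≤ 8 * B ^ 2 * v := by positivity
  have hbB : 0 ≤ 24 * B ^ 2 * v ^ 2 := by positivity
  have hbC : 0 ≤ 4 * (ζ * B * B * v * v) := by positivity
  have h01 : ∀ (c : Prop) [Decidable c], (0 : ℝ) ≤ (if c then (1 : ℝ) else 0) := fun c _ => by
    split_ifs <;> norm_num
  -- the six overlap indicators
  set t1 : ℝ := if k = i ∧ l = j then (1 : ℝ) else 0 with ht1
  set t2 : ℝ := if k = j ∧ l = i then (1 : ℝ) else 0 with ht2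
  set t3 : ℝ := if k = i then (1 : ℝ) else 0 with ht3
  set t4 : ℝ := if k = j then (1 : ℝ) else 0 with ht4
  set t5 : ℝ := if l = i then (1 : ℝ) else 0 with ht5
  set t6 : ℝ := if l = j then (1 : ℝ) else 0 with ht6
  have n1 : 0 ≤ 8 * B ^ 2 * v * t1 := mul_nonneg hbA (h01 _)
  have n2 : 0 ≤ 8 * B ^ 2 * v * t2 := mul_nonneg hbA (h01 _)
  have n3 : 0 ≤ 24 * B ^ 2 * v ^ 2 * t3 := mul_nonneg hbB (h01 _)
  have n4 : 0 ≤ 24 * B ^ 2 * v ^ 2 * t4 := mul_nonneg hbB (h01 _)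
  have n5 : 0 ≤ 24 * B ^ 2 * v ^ 2 * t5 := mul_nonneg hbB (h01 _)
  have n6 : 0 ≤ 24 * B ^ 2 * v ^ 2 * t6 := mul_nonneg hbB (h01 _)
  -- the measurable decorated variables and their support bounds
  have hm := fun a b : Fin (N + 1) => measurable_decorated (N := N) hh hφ a b
  have hE := fun a b : Fin (N + 1) => abs_decorated_le_indicator (N := N) hh1 hφB hφD a b
  have hE' := fun a b : Fin (N + 1) => abs_decorated_le_indicator' (N := N) hh1 hφB hDs hφD a b
  have hbd := fun a b : Fin (N + 1) => abs_decorated_le (N := N) hh1 hφB a b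
  by_cases hki : k = i
  · by_cases hlj : l = j
    · -- both labels shared, same orientation
      have e : 8 * B ^ 2 * v * t1 = 8 * B ^ 2 * v := by rw [show t1 = 1 from if_pos ⟨hki, hlj⟩, mul_one]
      have hc : |cov[fun x => h (x i) * φ (x j - x i), fun x => h (x k) * φ (x l - x k);
          posGibbsMeasure (fun _ : T3 => (1 : ℝ)) (hsDiameter σ N) (N + 1)]| ≤ 8 * B ^ 2 * v :=
        abs_covariance_le_of_pairEvent hsd hN (hm i j) (hm k l) hB.le hD (s := i) (a := j) hij (hE i j) (hbd k l)
      linarith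
    · -- shared label `i = k`, partners `j ≠ l`
      have e : 24 * B ^ 2 * v ^ 2 * t3 = 24 * B ^ 2 * v ^ 2 := by rw [show t3 = 1 from if_pos hki, mul_one]
      have hc : |cov[fun x => h (x i) * φ (x j - x i), fun x => h (x k) * φ (x l - x k);
          posGibbsMeasure (fun _ : T3 => (1 : ℝ)) (hsDiameter σ N) (N + 1)]| ≤ 24 * B ^ 2 * v ^ 2 :=
        abs_covariance_le_of_tripleEvent hsd hN (hm i j) (hm k l) hB.le hD (s := i) (a := j) (b := l) hij
          (fun h' => hkl (hki.trans h')) (Ne.symm hlj) (hE i j) (fun x => by simpa only [hki] using hE k l x)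
      linarith
  · by_cases hkj : k = j
    · by_cases hli : l = i
      · -- both labels shared, opposite orientation
        have e : 8 * B ^ 2 * v * t2 = 8 * B ^ 2 * v := by rw [show t2 = 1 from if_pos ⟨hkj, hli⟩, mul_one]
        have hc : |cov[fun x => h (x i) * φ (x j - x i), fun x => h (x k) * φ (x l - x k);
            posGibbsMeasure (fun _ : T3 => (1 : ℝ)) (hsDiameter σ N) (N + 1)]| ≤ 8 * B ^ 2 * v :=
          abs_covariance_le_of_pairEvent hsd hN (hm i j) (hm k l) hB.le hD (s := i) (a := j) hij (hE i j) (hbd k l)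
        linarith
      · -- shared label `j = k`, partners `i ≠ l`
        have e : 24 * B ^ 2 * v ^ 2 * t4 = 24 * B ^ 2 * v ^ 2 := by rw [show t4 = 1 from if_pos hkj, mul_one]
        have hc : |cov[fun x => h (x i) * φ (x j - x i), fun x => h (x k) * φ (x l - x k);
            posGibbsMeasure (fun _ : T3 => (1 : ℝ)) (hsDiameter σ N) (N + 1)]| ≤ 24 * B ^ 2 * v ^ 2 :=
          abs_covariance_le_of_tripleEvent hsd hN (hm i j) (hm k l) hB.le hD (s := j) (a := i) (b := l) hij.symm
            (fun h' => hkl (hkj.trans h')) (Ne.symm hli) (hE' i j) (fun x => by simpa only [hkj] using hE k l x)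
        linarith
    · by_cases hli : l = i
      · -- shared label `i = l`, partners `j ≠ k`
        have e : 24 * B ^ 2 * v ^ 2 * t5 = 24 * B ^ 2 * v ^ 2 := by rw [show t5 = 1 from if_pos hli, mul_one]
        have hc : |cov[fun x => h (x i) * φ (x j - x i), fun x => h (x k) * φ (x l - x k);
            posGibbsMeasure (fun _ : T3 => (1 : ℝ)) (hsDiameter σ N) (N + 1)]| ≤ 24 * B ^ 2 * v ^ 2 :=
          abs_covariance_le_of_tripleEvent hsd hN (hm i j) (hm k l) hB.le hD (s := i) (a := j) (b := k) hij
            (Ne.symm hki) (Ne.symm hkj) (hE i j) (fun x => by simpa only [hli] using hE' k l x)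
        linarith
      · by_cases hlj : l = j
        · -- shared label `j = l`, partners `i ≠ k`
          have e : 24 * B ^ 2 * v ^ 2 * t6 = 24 * B ^ 2 * v ^ 2 := by rw [show t6 = 1 from if_pos hlj, mul_one]
          have hc : |cov[fun x => h (x i) * φ (x j - x i), fun x => h (x k) * φ (x l - x k);
              posGibbsMeasure (fun _ : T3 => (1 : ℝ)) (hsDiameter σ N) (N + 1)]| ≤ 24 * B ^ 2 * v ^ 2 :=
            abs_covariance_le_of_tripleEvent hsd hN (hm i j) (hm k l) hB.le hD (s := j) (a := i) (b := k) hij.symm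
              (Ne.symm hkj) (Ne.symm hki) (hE' i j) (fun x => by simpa only [hlj] using hE' k l x)
          linarith
        · -- four distinct labels
          have hc := abs_covariance_decorated_le_of_dec hsd hh hh1 hφ hB hφB hφD hζ
            (hdec i j k l hij (Ne.symm hki) (Ne.symm hli) (Ne.symm hkj) (Ne.symm hlj) hkl)
          linarith

/-- `Σ_k Σ_l 𝟙[k = i ∧ l = j] = 1`. [folklore] -/
theorem sum_sum_ite_and_eq (i j : Fin (N + 1)) :
    ∑ k : Fin (N + 1), ∑ l : Fin (N + 1), (if k = i ∧ l = j then (1 : ℝ) else 0) = 1 := by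
  have h : ∀ k : Fin (N + 1), ∑ l : Fin (N + 1), (if k = i ∧ l = j then (1 : ℝ) else 0) =
      if k = i then 1 else 0 := by
    intro k
    by_cases hk : k = i
    · simp only [hk, true_and, if_true, Finset.sum_ite_eq', Finset.mem_univ]
    · simp [hk]
  simp_rw [h]; simp

/-- `Σ_k Σ_l 𝟙[k = i] = N + 1` and `Σ_k Σ_l 𝟙[l = i] = N + 1`. [folklore] -/
theorem sum_sum_ite_eq (i : Fin (N + 1)) :
    ∑ k : Fin (N + 1), ∑ _l : Fin (N + 1), (if k = i then (1 : ℝ) else 0) = (N + 1 : ℕ) ∧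
      ∑ _k : Fin (N + 1), ∑ l : Fin (N + 1), (if l = i then (1 : ℝ) else 0) = (N + 1 : ℕ) := by
  constructor
  · simp only [Finset.sum_const, Finset.card_univ, Fintype.card_fin, nsmul_eq_mul]
    rw [← Finset.mul_sum]
    simp
  · simp only [Finset.sum_ite_eq', Finset.mem_univ, if_true, Finset.sum_const, Finset.card_univ,
      Fintype.card_fin, nsmul_eq_mul, mul_one]

/-- **Variance of the decorated pair sum.**  At small density, `N ≥ 1`, for measurable `|h| ≤ 1`,
measurable `|φ| ≤ B` supported in a measurable symmetric `D` of Haar volume `v`, and GIVEN the decorated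
pair-pair decorrelation bound for indicators at level `ζ` (hypothesis `hdec`, four distinct labels),
`Var_{P_N}(Σ_{i≠j} h(xᵢ)φ(xⱼ − xᵢ)) ≤ (N+1)² (16 B² v + 96 (N+1) B² v² + 4 ζ (N+1)² B² v²)`. [folklore] -/
theorem variance_decoratedPairSum_le (hsd : SmallDensity uniformProfile σ) (hN : 1 ≤ N) {h φ : T3 → ℝ}
    (hh : Measurable h) (hh1 : ∀ y, |h y| ≤ 1) (hφ : Measurable φ) {B : ℝ} (hB : 0 < B)
    (hφB : ∀ d, |φ d| ≤ B) {D : Set T3} (hD : MeasurableSet D) (hDs : ∀ d, d ∈ D ↔ -d ∈ D)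
    (hφD : ∀ d, φ d ≠ 0 → d ∈ D) {ζ : ℝ} (hζ : 0 ≤ ζ)
    (hdec : ∀ i j k l : Fin (N + 1), i ≠ j → i ≠ k → i ≠ l → j ≠ k → j ≠ l → k ≠ l →
      ∀ T T' : Set T3, MeasurableSet T → MeasurableSet T' →
      |(∫ x, h (x i) * T.indicator (fun _ => (1 : ℝ)) (x j - x i) * (h (x k) * T'.indicator (fun _ => (1 : ℝ)) (x l - x k))
          ∂posGibbsMeasure (fun _ : T3 => (1 : ℝ)) (hsDiameter σ N) (N + 1)) -
        (∫ x, h (x i) * T.indicator (fun _ => (1 : ℝ)) (x j - x i) ∂posGibbsMeasure (fun _ : T3 => (1 : ℝ)) (hsDiameter σ N) (N + 1)) *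
        (∫ x, h (x k) * T'.indicator (fun _ => (1 : ℝ)) (x l - x k) ∂posGibbsMeasure (fun _ : T3 => (1 : ℝ)) (hsDiameter σ N) (N + 1))|
        ≤ ζ * (volume T).toReal * (volume T').toReal) :
    variance (fun x => ∑ i : Fin (N + 1), ∑ j : Fin (N + 1), if i ≠ j then h (x i) * φ (x j - x i) else 0)
        (posGibbsMeasure (fun _ : T3 => (1 : ℝ)) (hsDiameter σ N) (N + 1)) ≤
      ((N + 1 : ℕ) : ℝ) ^ 2 * (16 * B ^ 2 * (volume D).toReal +
        96 * ((N + 1 : ℕ) : ℝ) * B ^ 2 * (volume D).toReal ^ 2 +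
        4 * ζ * ((N + 1 : ℕ) : ℝ) ^ 2 * B ^ 2 * (volume D).toReal ^ 2) := by
  haveI := isProbabilityMeasure_posGibbsMeasure continuous_const (fun _ => one_pos) hsd.σ_lt_half.le N
  set P := posGibbsMeasure (fun _ : T3 => (1 : ℝ)) (hsDiameter σ N) (N + 1) with hP
  set v : ℝ := (volume D).toReal with hv
  -- the pair-indexed family
  set Xt : Fin (N + 1) × Fin (N + 1) → (Fin (N + 1) → T3) → ℝ :=
    fun p x => if p.1 ≠ p.2 then h (x p.1) * φ (x p.2 - x p.1) else 0 with hXt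
  have hXt_of_ne : ∀ p : Fin (N + 1) × Fin (N + 1), p.1 ≠ p.2 →
      Xt p = fun x => h (x p.1) * φ (x p.2 - x p.1) := fun p hp => by
    funext x; simp only [hXt, if_pos hp]
  have hXt_of_eq : ∀ p : Fin (N + 1) × Fin (N + 1), ¬ p.1 ≠ p.2 → Xt p = 0 := fun p hp => by
    funext x; simp only [hXt, if_neg hp, Pi.zero_apply]
  have hXt2 : ∀ p, MemLp (Xt p) 2 P := fun p => by
    by_cases hp : p.1 ≠ p.2
    · rw [hXt_of_ne p hp]
      exact memLp_two_of_abs_le' (measurable_decorated hh hφ p.1 p.2) (abs_decorated_le hh1 hφB p.1 p.2)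
    · rw [hXt_of_eq p hp]; exact memLp_const 0
  have hfun : (fun x => ∑ i : Fin (N + 1), ∑ j : Fin (N + 1), if i ≠ j then h (x i) * φ (x j - x i) else 0) =
      fun x => ∑ p : Fin (N + 1) × Fin (N + 1), Xt p x := by
    funext x; rw [Fintype.sum_prod_type]
  -- the bound per pair of pairs
  set bnd : Fin (N + 1) → Fin (N + 1) → Fin (N + 1) → Fin (N + 1) → ℝ := fun i j k l =>
    8 * B ^ 2 * v * ((if k = i ∧ l = j then (1 : ℝ) else 0) + (if k = j ∧ l = i then (1 : ℝ) else 0)) +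
      24 * B ^ 2 * v ^ 2 * ((if k = i then (1 : ℝ) else 0) + (if k = j then (1 : ℝ) else 0) +
        (if l = i then (1 : ℝ) else 0) + (if l = j then (1 : ℝ) else 0)) +
      4 * (ζ * B * B * v * v) with hbnd
  have h01 : ∀ (c : Prop) [Decidable c], (0 : ℝ) ≤ (if c then (1 : ℝ) else 0) := fun c _ => by
    split_ifs <;> norm_num
  have hv0 : 0 ≤ v := ENNReal.toReal_nonneg
  have hbnd0 : ∀ i j k l, 0 ≤ bnd i j k l := fun i j k l => by
    simp only [hbnd]
    have := h01 (k = i ∧ l = j); have := h01 (k = j ∧ l = i); have := h01 (k = i); have := h01 (k = j)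
    have := h01 (l = i); have := h01 (l = j)
    positivity
  have hcov : ∀ p q : Fin (N + 1) × Fin (N + 1), cov[Xt p, Xt q; P] ≤ bnd p.1 p.2 q.1 q.2 := by
    intro p q
    by_cases hp : p.1 ≠ p.2
    · by_cases hq : q.1 ≠ q.2
      · rw [hXt_of_ne p hp, hXt_of_ne q hq]
        exact (le_abs_self _).trans
          (abs_covariance_decorated_le hsd hN hh hh1 hφ hB hφB hD hDs hφD hζ hdec p.1 p.2 q.1 q.2 hp hq)
      · rw [hXt_of_eq q hq, covariance_zero_right]; exact hbnd0 _ _ _ _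
    · rw [hXt_of_eq p hp, covariance_zero_left]; exact hbnd0 _ _ _ _
  -- the summation of the bounds
  have hsum : ∀ i j : Fin (N + 1), ∑ k : Fin (N + 1), ∑ l : Fin (N + 1), bnd i j k l =
      16 * B ^ 2 * v + 96 * ((N + 1 : ℕ) : ℝ) * B ^ 2 * v ^ 2 + 4 * ζ * ((N + 1 : ℕ) : ℝ) ^ 2 * B ^ 2 * v ^ 2 := by
    intro i j
    have hA1 := sum_sum_ite_and_eq (N := N) i j
    have hA2 := sum_sum_ite_and_eq (N := N) j i
    obtain ⟨hB1, hB3⟩ := sum_sum_ite_eq (N := N) i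
    obtain ⟨hB2, hB4⟩ := sum_sum_ite_eq (N := N) j
    have hC : ∑ _k : Fin (N + 1), ∑ _l : Fin (N + 1), (4 * (ζ * B * B * v * v)) =
        ((N + 1 : ℕ) : ℝ) ^ 2 * (4 * (ζ * B * B * v * v)) := by
      simp only [Finset.sum_const, Finset.card_univ, Fintype.card_fin, nsmul_eq_mul]; ring
    simp only [hbnd, Finset.sum_add_distrib, ← Finset.mul_sum, mul_add]
    rw [hA1, hA2, hB1, hB2, hB3, hB4]
    simp only [Finset.sum_const, Finset.card_univ, Fintype.card_fin, nsmul_eq_mul]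
    push_cast; ring
  rw [hfun, variance_fun_sum hXt2]
  calc ∑ p : Fin (N + 1) × Fin (N + 1), ∑ q : Fin (N + 1) × Fin (N + 1), cov[Xt p, Xt q; P]
      ≤ ∑ p : Fin (N + 1) × Fin (N + 1), ∑ q : Fin (N + 1) × Fin (N + 1), bnd p.1 p.2 q.1 q.2 :=
        Finset.sum_le_sum fun p _ => Finset.sum_le_sum fun q _ => hcov p q
    _ = ∑ i : Fin (N + 1), ∑ j : Fin (N + 1),
          (16 * B ^ 2 * v + 96 * ((N + 1 : ℕ) : ℝ) * B ^ 2 * v ^ 2 + 4 * ζ * ((N + 1 : ℕ) : ℝ) ^ 2 * B ^ 2 * v ^ 2) := by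
        rw [Fintype.sum_prod_type]
        refine Finset.sum_congr rfl fun i _ => Finset.sum_congr rfl fun j _ => ?_
        rw [Fintype.sum_prod_type]
        exact hsum i j
    _ = _ := by
        simp only [Finset.sum_const, Finset.card_univ, Fintype.card_fin, nsmul_eq_mul]; push_cast; ring

end Literature.MathematicalPhysics.KineticTheory

end
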